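import Literature.Analysis.Calculus.SardPrelim
import Mathlib.MeasureTheory.Covering.Besicovitch
import Mathlib.MeasureTheory.Covering.BesicovitchVectorSpace
import Mathlib.MeasureTheory.Constructions.BorelSpace.Metrizable
import HarnessLib

/-!
# Sard's theorem — Steps 2 and 3 of the inductive proof

Topic `Literature/Analysis/Calculus`. Two of the three local steps of the proof of Sard's theorem
by induction on the dimension of the source (Milnor, *Topology from the Differentiable Viewpoint*
(1965), §3, pp. 16–19, after Sard (1942) and Pontryagin), for a `C^∞` map `f : U → F` on an open
subset `U` of a finite-dimensional real normed space `E`, with values in a finite-dimensional real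
normed space `F` carrying an additive Haar measure `μ`:

* `measure_image_null_of_flat` (Milnor's **Step 3**): the image of
  `Cₖ = {x ∈ U | Dʲf(x) = 0, 1 ≤ j ≤ k}` is `μ`-null as soon as `k ≥ dim E` (flat Taylor estimate
  `‖f y - f x‖ ≤ c‖y - x‖ᵏ` and a Besicovitch covering by small balls; Milnor counts cubes).
* `exists_nhds_image_null_of_flat_of_ne` (Milnor's **Step 2**): around a point of `Cₖ ∖ Cₖ₊₁`
  (`k ≥ 1`) the image of `Cₖ` is null, GIVEN Sard's theorem in dimension `dim E - 1` (a suitable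
  `k`-th derivative `w` has `dw ≠ 0`; in the chart straightening `w`, `Cₖ` lies in the hyperplane
  `w = 0`, to which the induction hypothesis applies).
Milnor's **Step 1** (points of `C ∖ C₁`, by Fubini over hyperplane slices) is
`SardStepOne.exists_nhds_image_null_of_fderiv_ne_zero`; the induction itself and the named fact
`Literature.Analysis.Calculus.sard` are assembled in `SardProofs.lean`. All spaces live in a common
universe (the induction changes both source and target).

## References

* J. Milnor, *Topology from the Differentiable Viewpoint* (1965), §3, Steps 2–3. [MilnorTDV1965]
* A. Sard, *The measure of the critical values of differentiable maps*, Bull. AMS 48 (1942),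
  883–890, Thms. 4.1, 6.1, 7.1, 7.2. [Sard1942]
-/

open MeasureTheory Set Function Filter Metric
open scoped ContDiff Topology

noncomputable section

namespace Literature.Analysis.Calculus.Sard

universe u

/-! ### Step 3: flat points -/

/-- **Milnor's Step 3.** Let `f` be `C^∞` on an open set `U ⊆ E`, `F` nontrivial with additive Haar
measure `μ`, and `k ≥ max (dim E) 1`. Then the image of
`Cₖ = {x ∈ U | iteratedFDeriv ℝ j f x = 0 for 1 ≤ j ≤ k}` is `μ`-null: near `x ∈ Cₖ`,
`f (closedBall x r) ⊆ closedBall (f x) (c rᵏ)` with `c` arbitrarily small, and a Besicovitch cover of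
`Cₖ` by such balls has total `E`-volume `≤ vol + 1`, so `μ (f '' Cₖ) ≲ c`.
[cite: MilnorTDV1965, §3, Step 3 (p. 19)] -/
theorem measure_image_null_of_flat {E : Type u} [NormedAddCommGroup E] [NormedSpace ℝ E]
    [FiniteDimensional ℝ E] {F : Type u} [NormedAddCommGroup F] [NormedSpace ℝ F]
    [FiniteDimensional ℝ F] [MeasurableSpace F] [BorelSpace F] [Nontrivial F] (μ : Measure F)
    [μ.IsAddHaarMeasure] {f : E → F} {U : Set E} (hU : IsOpen U) (hf : ContDiffOn ℝ ∞ f U)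
    {k : ℕ} (hk : Module.finrank ℝ E ≤ k) (hk1 : 1 ≤ k) :
    μ (f '' {x ∈ U | ∀ j, 1 ≤ j → j ≤ k → iteratedFDeriv ℝ j f x = 0}) = 0 := by
  borelize E
  set d := Module.finrank ℝ E with hd
  set n := Module.finrank ℝ F with hn
  have hn1 : 1 ≤ n := Module.finrank_pos
  let μE : Measure E := Measure.addHaar
  apply measure_image_null_of_locally
  intro x₀ _
  refine ⟨ball x₀ 1, ball_mem_nhds _ one_pos, ?_⟩
  set s := {x ∈ U | ∀ j, 1 ≤ j → j ≤ k → iteratedFDeriv ℝ j f x = 0} ∩ ball x₀ 1 with hs_def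
  have hsU : s ⊆ U := fun x hx => hx.1.1
  have hμEs : μE s < ⊤ := (measure_mono inter_subset_right).trans_lt measure_ball_lt_top
  set a : ENNReal := μE (closedBall 0 1) with ha_def
  set b : ENNReal := μ (closedBall 0 1) with hb_def
  have ha0 : a ≠ 0 := (measure_closedBall_pos μE _ one_pos).ne'
  have hbtop : b ≠ ⊤ := measure_closedBall_lt_top.ne
  -- main estimate, for every `c ∈ (0, 1]`
  have key : ∀ c : ℝ, 0 < c → c ≤ 1 →
      μ (f '' s) * a ≤ ENNReal.ofReal c * (b * (μE s + 1)) := by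
    intro c hc hc1
    -- admissible radii around `x`
    let R : E → Set ℝ := fun x =>
      {r | 0 < r ∧ r ≤ 1 ∧ ∀ y ∈ closedBall x r, ‖f y - f x‖ ≤ c * ‖y - x‖ ^ k}
    have hR : ∀ x ∈ s, ∀ δ > 0, (R x ∩ Ioo 0 δ).Nonempty := by
      intro x hx δ hδ
      have hev := eventually_norm_sub_le_mul_pow_of_iteratedFDeriv_eq_zero hU hf (hsU hx) hk1
        hx.1.2 hc
      obtain ⟨ρ, hρ, hball⟩ := Metric.mem_nhds_iff.1 hev
      refine ⟨min (ρ / 2) (min (δ / 2) 1), ⟨by positivity, ?_, ?_⟩, by positivity, ?_⟩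
      · exact (min_le_right _ _).trans (min_le_right _ _)
      · intro y hy
        apply hball
        refine closedBall_subset_ball ?_ hy
        calc min (ρ / 2) (min (δ / 2) 1) ≤ ρ / 2 := min_le_left _ _
          _ < ρ := by linarith
      · calc min (ρ / 2) (min (δ / 2) 1) ≤ δ / 2 := (min_le_right _ _).trans (min_le_left _ _)
          _ < δ := by linarith
    obtain ⟨t, r, tc, -, hrt, hcover, hsum⟩ :=
      Besicovitch.exists_closedBall_covering_tsum_measure_le μE one_ne_zero R s hR
    -- bound for the image of each ball of the cover
    have hball_bound : ∀ x ∈ t, μ (f '' closedBall x (r x)) * a ≤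
        ENNReal.ofReal c * b * μE (closedBall x (r x)) := by
      intro x hx
      obtain ⟨hr0, hr1, hr⟩ := hrt x hx
      have hsub : f '' closedBall x (r x) ⊆ closedBall (f x) (c * r x ^ k) := by
        rintro _ ⟨y, hy, rfl⟩
        rw [mem_closedBall_iff_norm]
        refine (hr y hy).trans ?_
        rw [mem_closedBall_iff_norm] at hy
        gcongr
      have h1 : μ (f '' closedBall x (r x)) ≤ ENNReal.ofReal ((c * r x ^ k) ^ n) * b := by
        refine (measure_mono hsub).trans ?_
        rw [Measure.addHaar_closedBall' μ (f x) (by positivity)]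
      have h2 : (c * r x ^ k) ^ n ≤ c * r x ^ d := by
        have hle1 : c * r x ^ k ≤ 1 := by
          calc c * r x ^ k ≤ 1 * 1 := by
                gcongr
                exact pow_le_one₀ hr0.le hr1
            _ = 1 := one_mul 1
        calc (c * r x ^ k) ^ n ≤ (c * r x ^ k) ^ 1 :=
              pow_le_pow_of_le_one (by positivity) hle1 hn1
          _ = c * r x ^ k := pow_one _
          _ ≤ c * r x ^ d :=
              mul_le_mul_of_nonneg_left (pow_le_pow_of_le_one hr0.le hr1 hk) hc.le
      have h3 : μE (closedBall x (r x)) = ENNReal.ofReal (r x ^ d) * a :=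
        Measure.addHaar_closedBall' μE x hr0.le
      calc μ (f '' closedBall x (r x)) * a ≤ ENNReal.ofReal ((c * r x ^ k) ^ n) * b * a := by
            gcongr
        _ ≤ ENNReal.ofReal (c * r x ^ d) * b * a := by gcongr
        _ = ENNReal.ofReal c * b * (ENNReal.ofReal (r x ^ d) * a) := by
            rw [ENNReal.ofReal_mul hc.le]; ring
        _ = ENNReal.ofReal c * b * μE (closedBall x (r x)) := by rw [h3]
    calc μ (f '' s) * a ≤ μ (⋃ x ∈ t, f '' closedBall x (r x)) * a := by
          gcongr μ ?_ * a
          rw [← image_iUnion₂]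
          exact image_mono hcover
      _ ≤ (∑' x : t, μ (f '' closedBall x (r x))) * a := by
          gcongr
          exact measure_biUnion_le μ tc _
      _ = ∑' x : t, μ (f '' closedBall x (r x)) * a := ENNReal.tsum_mul_right.symm
      _ ≤ ∑' x : t, ENNReal.ofReal c * b * μE (closedBall x (r x)) :=
          ENNReal.tsum_le_tsum fun x => hball_bound x x.2
      _ = ENNReal.ofReal c * b * ∑' x : t, μE (closedBall x (r x)) := ENNReal.tsum_mul_left
      _ ≤ ENNReal.ofReal c * b * (μE s + 1) := by gcongr
      _ = ENNReal.ofReal c * (b * (μE s + 1)) := by ring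
  -- let `c → 0⁺`
  have hM : b * (μE s + 1) ≠ ⊤ := ENNReal.mul_ne_top hbtop (by simpa using hμEs.ne)
  have hT : Tendsto (fun c : ℝ => ENNReal.ofReal c * (b * (μE s + 1))) (𝓝[>] 0) (𝓝 0) := by
    have h1 : Tendsto (fun c : ℝ => ENNReal.ofReal c * (b * (μE s + 1))) (𝓝 0)
        (𝓝 (ENNReal.ofReal 0 * (b * (μE s + 1)))) :=
      ENNReal.Tendsto.mul_const (ENNReal.tendsto_ofReal tendsto_id) (Or.inr hM)
    simp only [ENNReal.ofReal_zero, zero_mul] at h1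
    exact h1.mono_left nhdsWithin_le_nhds
  have hle : μ (f '' s) * a ≤ 0 := by
    refine ge_of_tendsto hT ?_
    filter_upwards [Ioc_mem_nhdsGT one_pos] with c hc
    exact key c hc.1 hc.2
  have : μ (f '' s) * a = 0 := nonpos_iff_eq_zero.1 hle
  exact (mul_eq_zero.1 this).resolve_right ha0

/-! ### Step 2: points of `Cₖ ∖ Cₖ₊₁`, `k ≥ 1` -/

/-- **Milnor's Step 2.** Let `dim E = m + 1`, let `F` be nontrivial with additive Haar measure `μ`,
and assume Sard's theorem for `C^∞` maps into `F` from open subsets of `m`-dimensional spaces.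
If `f` is `C^∞` on the open set `U`, `k ≥ 1`, and `x₀ ∈ U` has `iteratedFDeriv ℝ (k+1) f x₀ ≠ 0`,
then `x₀` has a neighbourhood `V` such that `f '' (Cₖ ∩ V)` is `μ`-null, where
`Cₖ = {x ∈ U | iteratedFDeriv ℝ j f x = 0, 1 ≤ j ≤ k}`. (Some `w = π ∘ Dᵏf(·)(v₁,…,vₖ)` vanishes on
`Cₖ` and has `dw(x₀) ≠ 0`; in the chart straightening `w`, `Cₖ` lies in the hyperplane `{w = 0}`,
on which every point of `Cₖ` is critical for the restriction of `f`.)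
[cite: MilnorTDV1965, §3, Step 2 (p. 18)] -/
theorem exists_nhds_image_null_of_flat_of_ne {E : Type u} [NormedAddCommGroup E]
    [NormedSpace ℝ E] [FiniteDimensional ℝ E] {F : Type u} [NormedAddCommGroup F]
    [NormedSpace ℝ F] [FiniteDimensional ℝ F] [MeasurableSpace F] [BorelSpace F] [Nontrivial F]
    (μ : Measure F) [μ.IsAddHaarMeasure] {m : ℕ} (hE : Module.finrank ℝ E = m + 1)
    (IH : ∀ (E' : Type u) [NormedAddCommGroup E'] [NormedSpace ℝ E'] [FiniteDimensional ℝ E'],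
      Module.finrank ℝ E' = m → ∀ (g : E' → F) (W : Set E'), IsOpen W → ContDiffOn ℝ ∞ g W →
        μ (g '' {y ∈ W | ¬ Surjective (fderiv ℝ g y)}) = 0)
    {f : E → F} {U : Set E} (hU : IsOpen U) (hf : ContDiffOn ℝ ∞ f U) {k : ℕ} (hk : 1 ≤ k)
    {x₀ : E} (hx₀ : x₀ ∈ U) (hne : iteratedFDeriv ℝ (k + 1) f x₀ ≠ 0) :
    ∃ V ∈ 𝓝 x₀,
      μ (f '' ({x ∈ U | ∀ j, 1 ≤ j → j ≤ k → iteratedFDeriv ℝ j f x = 0} ∩ V)) = 0 := by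
  -- a multi-vector `M` and a functional `π` detecting `D^{k+1} f(x₀) ≠ 0`
  obtain ⟨M, hM⟩ : ∃ M : Fin (k + 1) → E, iteratedFDeriv ℝ (k + 1) f x₀ M ≠ 0 := by
    by_contra h
    push Not at h
    exact hne (ContinuousMultilinearMap.ext fun M => by simpa using h M)
  set q : F := iteratedFDeriv ℝ (k + 1) f x₀ M with hq
  obtain ⟨π, -, hπ⟩ := exists_dual_vector ℝ q (norm_ne_zero_iff.2 hM)
  have hπq : π q ≠ 0 := by
    rw [hπ]
    exact_mod_cast norm_ne_zero_iff.2 hM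
  -- the function `w` and its smoothness
  set w : E → ℝ := fun x => π (iteratedFDeriv ℝ k f x (Fin.tail M)) with hw_def
  have hDk : ContDiffOn ℝ ∞ (iteratedFDeriv ℝ k f) U := fun x hx =>
    ((hf.contDiffAt (hU.mem_nhds hx)).iteratedFDeriv_right (i := k) (m := ∞)
      (by exact_mod_cast le_top)).contDiffWithinAt
  have hw : ContDiffOn ℝ ∞ w U := by
    have h1 : ContDiff ℝ ∞ fun T : E [×k]→L[ℝ] F => π (T (Fin.tail M)) :=
      π.contDiff.comp
        (ContinuousMultilinearMap.apply ℝ (fun _ : Fin k => E) F (Fin.tail M)).contDiff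
    exact h1.comp_contDiffOn hDk
  -- its derivative at `x₀` does not vanish
  have hdiffk : DifferentiableAt ℝ (iteratedFDeriv ℝ k f) x₀ :=
    (hDk.differentiableOn (by simp) x₀ hx₀).differentiableAt (hU.mem_nhds hx₀)
  set ℓ : E →L[ℝ] ℝ := fderiv ℝ w x₀ with hℓ_def
  have hℓM : ℓ (M 0) = π q := by
    have hin : DifferentiableAt ℝ (fun x => iteratedFDeriv ℝ k f x (Fin.tail M)) x₀ :=
      hdiffk.continuousMultilinear_apply_const (Fin.tail M)
    have h1 : fderiv ℝ w x₀ = (π : F →L[ℝ] ℝ).comp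
        (fderiv ℝ (fun x => iteratedFDeriv ℝ k f x (Fin.tail M)) x₀) :=
      (π.hasFDerivAt.comp x₀ hin.hasFDerivAt).fderiv
    rw [hℓ_def, h1, ContinuousLinearMap.comp_apply, hq, hdiffk.iteratedFDeriv_succ_apply_left']
  have hℓ0 : ℓ ≠ 0 := by
    intro h
    apply hπq
    rw [← hℓM, h]
    rfl
  -- the chart straightening `w`
  obtain ⟨Φ, hΦ⟩ := exists_equiv_prod_ker_fst_eq ℓ hℓ0
  obtain ⟨e, hx₀e, heU, he, hesymm⟩ := exists_chart_fst_eq Φ hΦ hU hw hx₀ rfl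
  refine ⟨e.source, e.open_source.mem_nhds hx₀e, ?_⟩
  -- the restriction of `f ∘ e.symm` to the hyperplane `{0} × ker ℓ`
  set W : Set ℓ.ker := {y | ((0 : ℝ), y) ∈ e.target} with hW_def
  have hW : IsOpen W := e.open_target.preimage (Continuous.prodMk_right 0)
  set g : ℓ.ker → F := fun y => f (e.symm ((0 : ℝ), y)) with hg_def
  have hmaps : ∀ y ∈ W, e.symm ((0 : ℝ), y) ∈ U := fun y hy => heU (e.map_target hy)
  have hg : ContDiffOn ℝ ∞ g W := by
    have h1 : ContDiffOn ℝ ∞ (fun y : ℓ.ker => e.symm ((0 : ℝ), y)) W :=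
      hesymm.comp (contDiff_prodMk_right (0 : ℝ)).contDiffOn fun y hy => hy
    exact hf.comp h1 hmaps
  have hdim : Module.finrank ℝ ℓ.ker = m := by
    have := finrank_ker_add_one_eq ℓ Φ
    omega
  have hIH := IH ℓ.ker hdim g W hW hg
  refine measure_mono_null ?_ hIH
  rintro _ ⟨x, ⟨⟨hxU, hxflat⟩, hxe⟩, rfl⟩
  -- `x ∈ Cₖ ∩ e.source` is mapped into the hyperplane
  have hwx : w x = 0 := by
    simp [hw_def, hxflat k hk le_rfl]
  have hex : e x = ((0 : ℝ), (Φ x).2) := by rw [he x, hwx]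
  have hy_t : ((0 : ℝ), (Φ x).2) ∈ e.target := hex ▸ e.map_source hxe
  have hsymm : e.symm ((0 : ℝ), (Φ x).2) = x := hex ▸ e.left_inv hxe
  refine ⟨(Φ x).2, ⟨hy_t, ?_⟩, by simp [hg_def, hsymm]⟩
  -- `df(x) = 0`, hence the restriction is critical at the corresponding point
  have hfd : fderiv ℝ f x = 0 := by
    have h1 := hxflat 1 le_rfl hk
    rw [← norm_eq_zero, ← norm_iteratedFDeriv_one (𝕜 := ℝ) f, h1, norm_zero]
  have hdg : fderiv ℝ g (Φ x).2 = 0 := by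
    have hd1 : DifferentiableAt ℝ (fun y : ℓ.ker => e.symm ((0 : ℝ), y)) (Φ x).2 :=
      ((hesymm.differentiableOn (by simp) _ hy_t).differentiableAt
        (e.open_target.mem_nhds hy_t)).comp _
        ((differentiableAt_const _).prodMk differentiableAt_id)
    have hd2 : DifferentiableAt ℝ f (e.symm ((0 : ℝ), (Φ x).2)) := by
      rw [hsymm]
      exact (hf.differentiableOn (by simp) x hxU).differentiableAt (hU.mem_nhds hxU)
    rw [show g = f ∘ fun y : ℓ.ker => e.symm ((0 : ℝ), y) from rfl,
      fderiv_comp ((Φ x).2) (g := f) (f := fun y : ℓ.ker => e.symm ((0 : ℝ), y)) hd2 hd1, hsymm,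
      hfd, ContinuousLinearMap.zero_comp]
  intro hsurj
  rw [hdg] at hsurj
  obtain ⟨v, hv⟩ := exists_ne (0 : F)
  obtain ⟨u, hu⟩ := hsurj v
  exact hv (by simpa using hu.symm)

end Literature.Analysis.Calculus.Sard
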